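import Literature.AlgebraicGeometry.HodgeTheory.MotivatedClassesCupProduct
import Literature.AlgebraicGeometry.HodgeTheory.LefschetzPrimitivePartsSemiconj
import Literature.AlgebraicTopology.SingularHomology.GysinTransposition
import Literature.AlgebraicGeometry.Motives.ComplexPointsManifold
import HarnessLib

/-!
# André's Prop. 2.2 engine on the real carriers: `*_θ` is self-adjoint for the cup product, and the motivated
# correspondence `*_Θ(Δ_* ηˡ)` inverts `Lˡ` on the top of every Lefschetz string of length `l`

Y. André, *Pour une théorie inconditionnelle des motifs*, Publ. Math. IHÉS 83 (1996), Prop. 2.2 (p. 16: the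
Lefschetz involution `*_L` of a polarised `X` is a MOTIVATED correspondence, hence Cor. 1 «`A_mot(X)` est stable
sous `*`» and Cor. 2, the Lefschetz decomposition inside `A_mot(X)`), proof p. 16: «il suffit de montrer que pour
tout `i ≤ d`, il existe un élément de `C_mot(X, X)` induisant l'inverse de `L^{d-i}` sur `L^{d-i}Pⁱ(X)`. Considérons
`*_{X²}(L^{d-i}) ∈ *_{X²}A(X²) ⊂ A_mot(X × X)` … sur `L^{d-i}Pⁱ(X) ⊗ L^{d-i}Pⁱ(X)`, `*_{X²}` est donnée à un facteur
`K ∈ ℚ*` près par `* ⊗ *` (lemme 1.3.1) … parce que `*` est son propre transposé».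

Part 1 (linear-algebra tools on `H•(X(ℂ); ℂ)`):
* §1 `cupProduct_lefschetzPowTo_eq_zero_of_ne` — primitive classes of DIFFERENT degrees are cup-orthogonal after
  any power of `L` landing in the top degree (Voisin I Lemma 6.29);
* §2 `cupProduct_lefschetzInvolution_comm` — **«`*` est son propre transposé»**: `(*_θ c) ∪ v = c ∪ (*_θ v)` in
  `H^{2D}(Z(ℂ); ℂ)` for `c`, `v` of the same degree (André's sign-free `*_θ`; term by term on the two Lefschetz
  decompositions, `*_θ (Lᵏ p) = Lˢ p` with `i + k + s = D`);
* §3 `map_lift_cross` — `Δ^*(fst^* a ∪ snd^* b) = a ∪ b`; `cupPairing_corrClassAction` — the cup pairing of a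
  correspondence action: `⟨u^*(x), y⟩_W = (-1)^{deg x · deg y} ⟨u ∪ (fst^* y ∪ snd^* x), [W ⊗ X]⟩` (projection
  formula / transposition of the Gysin map, Fulton App. B (5)–(6), the tree's `cupPairing_gysinMap`);
* §4 `exists_eq_smul_of_ker_le` — two linear forms with nested kernels are proportional.

Part 2 (for `X` smooth projective of dimension `n`, `η` with the hard Lefschetz property, `Θ = fst^* η + snd^* η` on
`X ⊗ X`, orientations `μ`, `ν` with Poincaré duality, `i + l = n`, and the class `c_l = Δ_*(ηˡ) = Δ_*(Lˡ 1) ∈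
H^{2n+2l}((X ⊗ X)(ℂ); ℂ)`):
* §1 tools: the top monomial with a free target degree; `Lˡ Δ^*` kills the blocks of primitive pairs of different
  degrees (primitive orthogonality); a sign lemma;
* §2 `cupPairing_corrClassAction_star_gysinDiag` — the MASTER FORMULA
  `⟨(*_Θ c_l)^*(x), y⟩_ν = ± ⟨Lˡ Δ^*(*_Θ(fst^* y ∪ snd^* x)), [X]_ν⟩`;
* §3 `exists_cupPairing_corrClassAction_star_eq_mul` — for `p ∈ Pⁱ` and every `y`:
  `⟨(*_Θ c_l)^*(Lˡ p), y⟩ = C_y · ⟨p, y⟩` with `C_y ≠ 0` (only the Lefschetz component of `y` of primitive degree `i`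
  survives, by orthogonality and block stability of `*_Θ`; on it Lemme 1.3.1 gives the top constant);
* §4 **`exists_corrClassAction_star_lefschetzPowTo_eq_smul`** — `(*_Θ c_l)^*(Lˡ p) = λ • p` with `λ ≠ 0` (perfectness
  of the cup pairing of the closed manifold `X(ℂ)`, Hatcher Prop. 3.38): the correspondence `*_Θ(c_l)`, which is
  MOTIVATED (`*` of an algebraic class), inverts `Lˡ` on the top `Lˡ Pⁱ` of the strings of length `l`, up to a
  non-zero scalar.

Theorems only: no definition, no named fact.

Provenance: Literature home (namespace `Literature.AlgebraicGeometry.HodgeTheory.MotivatedAlgebra`) of the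
Summits-side `HodgeConjecture/Theorems/Ring2HypothesesDescentMotivatedStarAdjoint` (Part 1) and
`…/Ring2HypothesesDescentMotivatedStringTop` (Part 2) (imports `Literature/` and Mathlib only). Lane `lit-hodgefound`,
seat p20.

## References

* [Andre1996Motifs] Y. André, *Pour une théorie inconditionnelle des motifs*, Publ. Math. IHÉS 83 (1996), §1.1
  (p. 10), §1.3 Lemme 1.3.1 (p. 13), Prop. 2.2 (p. 16).
* [Kleiman1968AlgebraicCycles] S. Kleiman, *Algebraic cycles and the Weil conjectures* (1968), §1.4, 1.4.4–1.4.6.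
* [VoisinHodgeI2002] C. Voisin, *Hodge Theory and Complex Algebraic Geometry I* (2002), §6.2.3 Cor. 6.26,
  Lemma 6.29.
* [VoisinHodgeII2003] C. Voisin, *Hodge Theory and Complex Algebraic Geometry II* (2003), proof of Thm. 10.17
  (10.7).
* [FultonYoungTableaux1997] W. Fulton, *Young Tableaux* (1997), App. B (5)–(6).
* [HatcherAT2002] A. Hatcher, *Algebraic Topology* (2002), §3.2 Prop. 3.10, Thm. 3.11, §3.3 p. 249, Prop. 3.38.
-/

noncomputable section

namespace Literature.AlgebraicGeometry.HodgeTheory.MotivatedAlgebra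

open _root_.CategoryTheory _root_.AlgebraicGeometry MonoidalCategory CartesianMonoidalCategory
open Literature.AlgebraicTopology.SingularHomology Literature.Geometry.Kaehler
open Literature.AlgebraicGeometry Literature.AlgebraicGeometry.Motives
open Literature.AlgebraicGeometry.HodgeTheory.MotivatedPullback

/-! ## Part 1: `*_θ` is self-adjoint; primitive orthogonality; the cup pairing of a correspondence action -/

section Part1

universe u v

/-! ## §1 Primitive classes of different degrees are cup-orthogonal -/

/-- **Orthogonality of the Lefschetz decomposition** (Voisin I Lemma 6.29 / proof of Thm. 6.32): for `p ∈ Pⁱ`,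
`q ∈ P^{i'}` primitive (for `κ`, dimension `n`) with `i ≠ i'` and `i + 2e + i' = 2n`, `(Lᵉ p) ∪ q = 0` in
`H^{2n}(Y; R)` — moving `Lᵉ` onto the factor of larger primitive degree kills it past the top of its string.
[cite: VoisinHodgeI2002, §6.2.3 Lemma 6.29] [cite: HatcherAT2002, §3.2 Thm. 3.11] -/
theorem cupProduct_lefschetzPowTo_eq_zero_of_ne {Y : Type u} [TopologicalSpace Y] {R : Type v} [CommRing R]
    {κ : singularCohomology R R Y 2} {n i i' e m : ℕ} {p : singularCohomology R R Y i}
    {q : singularCohomology R R Y i'} (hp : p ∈ primitiveClasses κ n i) (hq : q ∈ primitiveClasses κ n i')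
    (hne : i ≠ i') (hm : i + 2 * e = m) (h : m + i' = 2 * n) :
    cupProduct h (lefschetzPowTo κ e i m hm p) q = 0 := by
  rcases Nat.lt_or_gt_of_ne hne with hlt | hgt
  · -- `i < i'`: `Lᵉ q = 0`
    rw [cupProduct_lefschetzPowTo_left κ e hm h (rfl : i + i' = i + i') (by omega) p q,
      ← cupProduct_lefschetzPowTo_right κ e (rfl : i' + 2 * e = i' + 2 * e) (by omega) (rfl : i + i' = i + i')
        (by omega) p q,
      lefschetzPowTo_eq_zero_of_mem_primitiveClasses hq _ (by omega), map_zero]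
  · -- `i' < i`: `Lᵉ p = 0`
    rw [lefschetzPowTo_eq_zero_of_mem_primitiveClasses hp _ (by omega), map_zero, LinearMap.zero_apply]

/-- The same with the primitive class of larger… either degree on the left: `q ∪ (Lᵉ p) = 0` for `p ∈ Pⁱ`,
`q ∈ P^{i'}`, `i ≠ i'`, `i' + i + 2e = 2n`. [cite: VoisinHodgeI2002, §6.2.3 Lemma 6.29] -/
theorem cupProduct_lefschetzPowTo_eq_zero_of_ne' {Y : Type u} [TopologicalSpace Y] {R : Type v} [CommRing R]
    {κ : singularCohomology R R Y 2} {n i i' e m : ℕ} {p : singularCohomology R R Y i}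
    {q : singularCohomology R R Y i'} (hp : p ∈ primitiveClasses κ n i) (hq : q ∈ primitiveClasses κ n i')
    (hne : i ≠ i') (hm : i + 2 * e = m) (h : i' + m = 2 * n) :
    cupProduct h q (lefschetzPowTo κ e i m hm p) = 0 := by
  rw [cupProduct_lefschetzPowTo_right κ e hm h (rfl : i' + i = i' + i) (by omega) q p,
    ← cupProduct_lefschetzPowTo_left κ e (rfl : i' + 2 * e = i' + 2 * e) (by omega) (rfl : i' + i = i' + i)
      (by omega) q p]
  exact cupProduct_lefschetzPowTo_eq_zero_of_ne hq hp hne.symm rfl (by omega)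

/-! ## §2 `*_θ` is self-adjoint for the cup product -/

variable {D : ℕ} {Z : SchemeOver ℂ} {θ : complexBetti Z 2}

/-- One pair of Lefschetz components: for `p ∈ Hⁱ`, `q ∈ H^{i'}` (any classes), `i + 2k = a = i' + 2k'` and
`i + k ≤ D`, `i' + k' ≤ D`: `(*_θ Lᵏ p) ∪ (L^{k'} q) = (Lᵏ p) ∪ (*_θ L^{k'} q)` — both are `p ∪ Lᵉ q` with the
same `e` (`*_θ (Lᵏ p) = Lˢ p`, `i + k + s = D`). [cite: Andre1996Motifs, §1.1 (p. 10)] -/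
theorem cupProduct_lefschetzInvolution_lefschetzPowTo_comm (hθ : HasHardLefschetzProperty θ D) {a b i i' k k' : ℕ}
    (hab : a + b = 2 * D) (hba : b + a = 2 * D) (hk : i + 2 * k = a) (hk' : i' + 2 * k' = a) (hi : i + k ≤ D)
    (hi' : i' + k' ≤ D) (p : complexBetti Z i) (q : complexBetti Z i') :
    cupProduct hba (lefschetzInvolution hθ hab (lefschetzPowTo θ k i a hk p)) (lefschetzPowTo θ k' i' a hk' q) =
      cupProduct hab (lefschetzPowTo θ k i a hk p) (lefschetzInvolution hθ hab (lefschetzPowTo θ k' i' a hk' q)) := by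
  obtain ⟨s, hs⟩ : ∃ s, i + k + s = D := ⟨D - (i + k), by omega⟩
  obtain ⟨s', hs'⟩ : ∃ s', i' + k' + s' = D := ⟨D - (i' + k'), by omega⟩
  rw [lefschetzInvolution_lefschetzPowTo_eq hθ hs hk hab (show i + 2 * s = b by omega) p,
    lefschetzInvolution_lefschetzPowTo_eq hθ hs' hk' hab (show i' + 2 * s' = b by omega) q,
    cupProduct_lefschetzPowTo_lefschetzPowTo θ s k' (show i + 2 * s = b by omega) hk' hba
      (show i' + 2 * (s + k') = i' + 2 * (s + k') from rfl) (by omega) p q,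
    cupProduct_lefschetzPowTo_lefschetzPowTo θ k s' hk (show i' + 2 * s' = b by omega) hab
      (show i' + 2 * (k + s') = i' + 2 * (s + k') by omega) (by omega) p q,
    lefschetzPowTo_congr_exponent θ (show s + k' = k + s' by omega) _ _ q]

/-- **«`*` est son propre transposé»** (André 1996, proof of Prop. 2.2): for `Z` smooth projective of dimension `D`,
`θ ∈ H²(Z(ℂ); ℂ)` with the hard Lefschetz property and `c`, `v ∈ Hᵃ(Z(ℂ); ℂ)` (`a + b = 2D`), André's sign-free
involution satisfies `(*_θ c) ∪ v = c ∪ (*_θ v)` in `H^{2D}(Z(ℂ); ℂ)`. Proof: expand both classes in Lefschetz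
components (`exists_sum_lefschetzPowTo_eq`) and use `cupProduct_lefschetzInvolution_lefschetzPowTo_comm` term by
term. [cite: Andre1996Motifs, Prop. 2.2 (p. 16) and §1.1 (p. 10)] [cite: VoisinHodgeI2002, §6.2.3 Cor. 6.26] -/
theorem cupProduct_lefschetzInvolution_comm (hZ : IsSmoothProjective D Z) (hθ : HasHardLefschetzProperty θ D)
    {a b : ℕ} (hab : a + b = 2 * D) (hba : b + a = 2 * D) (c v : complexBetti Z a) :
    cupProduct hba (lefschetzInvolution hθ hab c) v = cupProduct hab c (lefschetzInvolution hθ hab v) := by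
  classical
  obtain ⟨s, p, -, hs, rfl⟩ := exists_sum_lefschetzPowTo_eq hZ hθ c
  obtain ⟨s', q, -, hs', rfl⟩ := exists_sum_lefschetzPowTo_eq hZ hθ v
  simp only [map_sum, LinearMap.sum_apply]
  refine Finset.sum_congr rfl fun ik' hik' ↦ Finset.sum_congr rfl fun ik hik ↦ ?_
  exact cupProduct_lefschetzInvolution_lefschetzPowTo_comm hθ hab hba ik.2 ik'.2 (hs ik hik) (hs' ik' hik') _ _

/-! ## §3 The diagonal and the cup pairing of a correspondence action -/

variable {n m : ℕ} {X W : SchemeOver ℂ}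

/-- **`Δ^*(fst^* a ∪ snd^* b) = a ∪ b`** for the diagonal `Δ = lift (𝟙 X) (𝟙 X) : X ⟶ X ⊗ X` (`f^*` is
multiplicative, Hatcher Prop. 3.10, and `Δ ≫ fst = 𝟙 = Δ ≫ snd`). [cite: HatcherAT2002, §3.2 Prop. 3.10] -/
theorem map_lift_cross {i j k : ℕ} (h : i + j = k) (a : complexBetti X i) (b : complexBetti X j) :
    complexBetti.map (lift (𝟙 X) (𝟙 X)) k
        (cupProduct h (complexBetti.map (fst X X) i a) (complexBetti.map (snd X X) j b)) = cupProduct h a b := by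
  rw [complexBetti.map, cupProduct_map]
  change cupProduct h ((complexBetti.map (fst X X) i ≫ complexBetti.map (lift (𝟙 X) (𝟙 X)) i) a)
    ((complexBetti.map (snd X X) j ≫ complexBetti.map (lift (𝟙 X) (𝟙 X)) j) b) = _
  rw [← complexBetti.map_comp, ← complexBetti.map_comp, lift_fst, lift_snd, complexBetti.map_id,
    complexBetti.map_id]
  rfl

/-- **The cup pairing of a correspondence action.** For `W`, `X` of dimensions `m`, `n`, orientations `μ` of
`(W ⊗ X)(ℂ)` and `ν` of `W(ℂ)` with `ν` satisfying Poincaré duality, `u ∈ H^{2e}((W ⊗ X)(ℂ))`, `x ∈ Hᵃ(X(ℂ))`,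
`y ∈ H^q(W(ℂ))`: `⟨u^*(x), y⟩_ν = (-1)^{a q} ⟨u ∪ (fst^* y ∪ snd^* x), [W ⊗ X]_μ⟩` (the cross product in any
spelling `s` of its degree `q + a`), where
`u^*(x) = fst_*(snd^* x ∪ u)` (`HodgeTheory.corrClassAction`): the Gysin map is the transpose of `fst^*`
(`cupPairing_gysinMap`, Fulton App. B (5)–(6)) and the cup product is associative and graded commutative (`u` has
even degree). [cite: FultonYoungTableaux1997, Appendix B §B.1 (5)–(6)] [cite: VoisinHodgeII2003, proof of Thm. 10.17 (10.7)]
[cite: HatcherAT2002, §3.2 Thm. 3.11 and §3.3 p. 249] -/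
theorem cupPairing_corrClassAction (μ : HomologicalOrientation ℂ (ComplexPoints (W ⊗ X)) (2 * (m + n)))
    (ν : HomologicalOrientation ℂ (ComplexPoints W) (2 * m)) (hν : ν.HasPoincareDuality) {e a b q : ℕ}
    (hab : a + 2 * e = b + 2 * n) (hq : b + q = 2 * m) {s : ℕ} (hqa : q + a = s) (h : 2 * e + s = 2 * (m + n))
    (u : complexBetti (W ⊗ X) (2 * e)) (x : complexBetti X a) (y : complexBetti W q) :
    cupPairing ν hq (corrClassAction μ ν hab hq u x) y =
      ((-1 : ℂ) ^ (a * q)) • cupPairing μ h u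
        (cupProduct hqa (complexBetti.map (fst W X) q y) (complexBetti.map (snd W X) a x)) := by
  rw [corrClassAction_apply, cupPairing_gysinMap hν, cupPairing_apply, cupPairing_apply]
  change kroneckerPairing ℂ ℂ _ _ (cupProduct _ (cupProduct rfl (complexBetti.map (snd W X) a x) u)
    (complexBetti.map (fst W X) q y)) _ = _
  rw [cupProduct_gradedComm_holds ℂ (ComplexPoints (W ⊗ X)) (rfl : a + 2 * e = a + 2 * e)
      (show 2 * e + a = a + 2 * e by omega) _ u,
    show ((-1 : ℂ) ^ (a * (2 * e))) = 1 by
      rw [show a * (2 * e) = 2 * (a * e) by ring, pow_mul, neg_one_sq, one_pow], one_smul,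
    cupProduct_assoc (show 2 * e + a = a + 2 * e by omega) (show a + q = s by omega)
      (show a + 2 * e + q = 2 * (m + n) by omega) h u _ _,
    cupProduct_gradedComm_holds ℂ (ComplexPoints (W ⊗ X)) (show a + q = s by omega) hqa _ _,
    LinearMap.map_smul, map_smul, LinearMap.smul_apply, smul_eq_mul]

/-! ## §4 Linear forms with nested kernels are proportional -/

/-- Two linear forms `K`, `L` on a vector space with `ker L ≤ ker K` are proportional: `K = c • L`
(Mathlib's `mem_span_of_iInf_ker_le_ker` for the one-element family). [cite: Andre1996Motifs, Prop. 2.2 (p. 16)] -/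
theorem exists_eq_smul_of_ker_le {𝕜 E : Type*} [Field 𝕜] [AddCommGroup E] [Module 𝕜 E] {K L : E →ₗ[𝕜] 𝕜}
    (h : LinearMap.ker L ≤ LinearMap.ker K) : ∃ c : 𝕜, K = c • L := by
  have hK : K ∈ Submodule.span 𝕜 (Set.range fun _ : Unit ↦ L) :=
    mem_span_of_iInf_ker_le_ker (by simpa only [iInf_const] using h)
  rw [Set.range_const, Submodule.mem_span_singleton] at hK
  obtain ⟨c, hc⟩ := hK
  exact ⟨c, hc.symm⟩

end Part1

/-! ## Part 2: The motivated correspondence `*_Θ(Δ_* ηˡ)` inverts `Lˡ` on the top of every Lefschetz string -/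

section Part2

variable {n : ℕ} {X : SchemeOver ℂ} {η : complexBetti X 2}

/-! ## §1 Tools -/

/-- Lemme 1.3.1 (`lefschetzInvolution_boxSum_topMono`) with a free spelling `M` of the target degree `i₁ + i₂`:
`*_θ (L₁^{m₁} p ⊠ L₂^{m₂} q) = c • (p ⊠ q)` in `Hᴹ`, `c ≠ 0`. [cite: Andre1996Motifs, §1.3 Lemme 1.3.1 (p. 13)] -/
theorem lefschetzInvolution_boxSum_topMono' {d₁ d₂ : ℕ} {V W : SchemeOver ℂ} {η₁ : complexBetti V 2}
    {η₂ : complexBetti W 2} {i₁ i₂ : ℕ} {p : complexBetti V i₁} {q : complexBetti W i₂}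
    (hV : IsSmoothProjective d₁ V) (hW : IsSmoothProjective d₂ W)
    (hθ : HasHardLefschetzProperty (complexBetti.map (fst V W) 2 η₁ + complexBetti.map (snd V W) 2 η₂) (d₁ + d₂))
    (hp : p ∈ primitiveClasses η₁ d₁ i₁) (hq : q ∈ primitiveClasses η₂ d₂ i₂) {m₁ m₂ : ℕ}
    (hm₁ : i₁ + m₁ = d₁) (hm₂ : i₂ + m₂ = d₂) {N M : ℕ} (hN : i₁ + 2 * m₁ + (i₂ + 2 * m₂) = N)
    (hM : i₁ + i₂ = M) (hNM : N + M = 2 * (d₁ + d₂)) :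
    ∃ c : ℂ, c ≠ 0 ∧
      lefschetzInvolution hθ hNM
          (cupProduct hN (complexBetti.map (fst V W) (i₁ + 2 * m₁) (lefschetzPowTo η₁ m₁ i₁ (i₁ + 2 * m₁) rfl p))
            (complexBetti.map (snd V W) (i₂ + 2 * m₂) (lefschetzPowTo η₂ m₂ i₂ (i₂ + 2 * m₂) rfl q))) =
        c • cupProduct hM (complexBetti.map (fst V W) i₁ p) (complexBetti.map (snd V W) i₂ q) := by
  subst hM
  exact lefschetzInvolution_boxSum_topMono hV hW hθ hp hq hm₁ hm₂ hN hNM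

/-- **`Lˡ ∘ Δ^*` kills the block of a primitive pair of different degrees** (in the complementary degree): for
`q ∈ P^{i'}`, `p ∈ Pⁱ` primitive for `η` (dimension `n`), `i' ≠ i`, and `w` in the span of the monomials
`fst^*(Lˢ q) ∪ snd^*(Lᵗ p)` of degree `b` with `b + 2l = 2n`: `Lˡ (Δ^* w) = 0` — since
`Lˡ Δ^*(Lˢ q ⊠ Lᵗ p) = (L^{s+l+t} q) ∪ p = 0` (primitive orthogonality, `cupProduct_lefschetzPowTo_eq_zero_of_ne`).
[cite: VoisinHodgeI2002, §6.2.3 Lemma 6.29] [cite: HatcherAT2002, §3.2 Prop. 3.10] -/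
theorem lefschetzPowTo_map_lift_eq_zero_of_mem_block {i i' b l : ℕ} {q : complexBetti X i'} {p : complexBetti X i}
    (hq : q ∈ primitiveClasses η n i') (hp : p ∈ primitiveClasses η n i) (hne : i' ≠ i) (hb : b + 2 * l = 2 * n)
    {w : complexBetti (X ⊗ X) b}
    (hw : w ∈ Submodule.span ℂ {z : complexBetti (X ⊗ X) b | ∃ (s t : ℕ) (h : i' + 2 * s + (i + 2 * t) = b),
        z = cupProduct h (complexBetti.map (fst X X) (i' + 2 * s) (lefschetzPowTo η s i' (i' + 2 * s) rfl q))
          (complexBetti.map (snd X X) (i + 2 * t) (lefschetzPowTo η t i (i + 2 * t) rfl p))}) :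
    lefschetzPowTo η l b (2 * n) hb (complexBetti.map (lift (𝟙 X) (𝟙 X)) b w) = 0 := by
  induction hw using Submodule.span_induction with
  | mem z hz =>
    obtain ⟨s, t, h, rfl⟩ := hz
    rw [map_lift_cross,
      ← cupProduct_lefschetzPowTo_left η l (rfl : i' + 2 * s + 2 * l = i' + 2 * s + 2 * l) (by omega) h hb,
      lefschetzPowTo_lefschetzPowTo η l rfl rfl (show i' + 2 * (s + l) = i' + 2 * s + 2 * l by omega) q,
      SmoothFamilyGysinKernel.cupProduct_lefschetzPowTo_lefschetzPowTo_left η (s + l) t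
        (show i' + 2 * (s + l) = i' + 2 * s + 2 * l by omega) rfl (by omega)
        (rfl : i' + 2 * (s + l + t) = i' + 2 * (s + l + t)) (by omega) q p]
    exact cupProduct_lefschetzPowTo_eq_zero_of_ne hq hp hne rfl (by omega)
  | zero => rw [map_zero, map_zero]
  | add z z' _ _ hz hz' => rw [map_add, map_add, hz, hz', add_zero]
  | smul a z _ hz => rw [map_smul, map_smul, hz, smul_zero]

/-- Sign lemma: `(Lˡ q) ∪ p = (-1)^{i·i} • (Lˡ p) ∪ q` for `p`, `q ∈ Hⁱ` (graded commutativity; `η` even).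
[cite: HatcherAT2002, §3.2 Thm. 3.11] -/
theorem cupProduct_lefschetzPowTo_swap {Y : SchemeOver ℂ} (κ : complexBetti Y 2) {i l a m : ℕ} (ha : i + 2 * l = a)
    (h : a + i = m) (p q : complexBetti Y i) :
    cupProduct h (lefschetzPowTo κ l i a ha q) p = ((-1 : ℂ) ^ (i * i)) • cupProduct h (lefschetzPowTo κ l i a ha p) q := by
  rw [cupProduct_lefschetzPowTo_left κ l ha h (rfl : i + i = i + i) (by omega) q p,
    cupProduct_gradedComm_holds ℂ (ComplexPoints Y) (rfl : i + i = i + i) rfl q p, map_smul,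
    ← cupProduct_lefschetzPowTo_left κ l ha h (rfl : i + i = i + i) (by omega) p q]

/-! ## §2 The master formula -/

/-- **MASTER FORMULA.** `X` smooth projective of dimension `n`, `η ∈ H²(X(ℂ); ℂ)`, `Θ = fst^* η + snd^* η` with the
hard Lefschetz property on the `2n`-fold `X ⊗ X`, orientations `μ` of `(X ⊗ X)(ℂ)` and `ν` of `X(ℂ)` with Poincaré
duality, `z ∈ H^k(X(ℂ))`, `c = Δ_* z` (the Gysin map of the diagonal, from `ν` to `μ`) of degree `N = a + a`, and
`u = *_Θ c ∈ H^{2e}`. Then for `x`, `y ∈ Hᵃ(X(ℂ))`: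
`⟨u^*(x), y⟩_ν = (-1)^{a·a} ⟨z ∪ Δ^*(*_Θ(fst^* y ∪ snd^* x)), [X]_ν⟩` — `⟨u^* x, y⟩ = ± ⟨u ∪ (y ⊠ x)⟩`
(`cupPairing_corrClassAction`), `(*_Θ c) ∪ v = c ∪ *_Θ v` (`cupProduct_lefschetzInvolution_comm`), and
`⟨Δ_* z ∪ w⟩ = ⟨z ∪ Δ^* w⟩` (`cupPairing_gysinMap`). [cite: Andre1996Motifs, Prop. 2.2 (p. 16)]
[cite: FultonYoungTableaux1997, Appendix B §B.1 (5)–(6)] -/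
theorem cupPairing_corrClassAction_star_gysinDiag (hX : IsSmoothProjective n X)
    (hΘ : HasHardLefschetzProperty (complexBetti.map (fst X X) 2 η + complexBetti.map (snd X X) 2 η) (n + n))
    (μ : HomologicalOrientation ℂ (ComplexPoints (X ⊗ X)) (2 * (n + n)))
    (ν : HomologicalOrientation ℂ (ComplexPoints X) (2 * n)) (hμ : μ.HasPoincareDuality) (hν : ν.HasPoincareDuality)
    {k e a b N : ℕ} (h₁ : k + 2 * e = 2 * n) (h₂ : N + 2 * e = 2 * (n + n)) (hab : a + 2 * e = b + 2 * n)
    (hq : b + a = 2 * n) (hN : a + a = N) (hba : 2 * e + N = 2 * (n + n)) (z : complexBetti X k)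
    (x y : complexBetti X a) :
    cupPairing ν hq
        (corrClassAction μ ν hab hq
          (lefschetzInvolution hΘ h₂
            (gysinMap ν μ (AlgPoints.mapContinuous (L := ℂ) (lift (𝟙 X) (𝟙 X))) h₁ h₂ z)) x) y =
      ((-1 : ℂ) ^ (a * a)) • cupPairing ν h₁ z
        (complexBetti.map (lift (𝟙 X) (𝟙 X)) (2 * e)
          (lefschetzInvolution hΘ h₂
            (cupProduct hN (complexBetti.map (fst X X) a y) (complexBetti.map (snd X X) a x)))) := by
  have hXX : IsSmoothProjective (n + n) (X ⊗ X) := IsSmoothProjective.tensor_holds hX hX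
  rw [cupPairing_corrClassAction μ ν hν hab hq hN hba, cupPairing_apply,
    cupProduct_lefschetzInvolution_comm hXX hΘ h₂ hba, ← cupPairing_apply, cupPairing_gysinMap hμ]

/-! ## §3 The pairing computation: only the component of primitive degree `i` survives -/

/-- **`⟨(*_Θ Δ_* Lˡ1)^*(Lˡ p), y⟩ = C_y · ⟨p, y⟩` with `C_y ≠ 0`.** Setting of the master formula with `z = Lˡ 1`,
`i + l = n`, `p ∈ Pⁱ` primitive, `x = Lˡ p ∈ Hᵃ` (`a = i + 2l`), and any `y ∈ Hᵃ`. Expanding `y = Σ_P Lᵗ ξ_P y`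
(Lefschetz decomposition by primitive parts): a component of primitive degree `i' ≠ i` contributes
`⟨Lˡ Δ^* *_Θ(Lᵗ ξ ⊠ Lˡ p)⟩ = 0` — `*_Θ` preserves the block of the primitive pair `(ξ, p)`
(`lefschetzInvolution_boxSum_mem_block`) and `Lˡ Δ^*` kills it (`lefschetzPowTo_map_lift_eq_zero_of_mem_block`);
the component of index `(i, l)` is the TOP monomial `Lˡ ξ ⊠ Lˡ p` of its block, `*_Θ` of which is `c₀ • (ξ ⊠ p)`,
`c₀ ≠ 0` (Lemme 1.3.1), contributing `c₀ ⟨(Lˡ ξ) ∪ p⟩ = ± c₀ ⟨(Lˡ p) ∪ ξ⟩ = ± c₀ ⟨p, y⟩` (cup-product bridge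
`cupProduct_lefschetzPowTo_primitivePart_eq`). [cite: Andre1996Motifs, §1.3 Lemme 1.3.1 (p. 13) and Prop. 2.2 (p. 16)]
[cite: VoisinHodgeI2002, §6.2.3 Cor. 6.26 and Lemma 6.29] -/
theorem exists_cupPairing_corrClassAction_star_eq_mul (hX : IsSmoothProjective n X) (hL : HasHardLefschetzProperty η n)
    (hΘ : HasHardLefschetzProperty (complexBetti.map (fst X X) 2 η + complexBetti.map (snd X X) 2 η) (n + n))
    (μ : HomologicalOrientation ℂ (ComplexPoints (X ⊗ X)) (2 * (n + n)))
    (ν : HomologicalOrientation ℂ (ComplexPoints X) (2 * n)) (hμ : μ.HasPoincareDuality) (hν : ν.HasPoincareDuality)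
    {i l a N : ℕ} (hil : i + l = n) (ha : i + 2 * l = a) (h0 : 0 + 2 * l = 2 * l) (h₁ : 2 * l + 2 * i = 2 * n)
    (hN : a + a = N) (h₂ : N + 2 * i = 2 * (n + n)) (hab : a + 2 * i = i + 2 * n) (hq : i + a = 2 * n)
    {p : complexBetti X i} (hp : p ∈ primitiveClasses η n i) (y : complexBetti X a) :
    ∃ C : ℂ, C ≠ 0 ∧
      cupPairing ν hq
          (corrClassAction μ ν hab hq
            (lefschetzInvolution hΘ h₂
              (gysinMap ν μ (AlgPoints.mapContinuous (L := ℂ) (lift (𝟙 X) (𝟙 X))) h₁ h₂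
                (lefschetzPowTo η l 0 (2 * l) h0 (singularCohomology.one ℂ (ComplexPoints X)))))
            (lefschetzPowTo η l i a ha p)) y =
        C * cupPairing ν hq p y := by
  classical
  have hvan : ∀ m, 2 * n < m → Subsingleton (complexBetti X m) := fun m hm ↦ subsingleton_complexBetti hX hm
  -- the index of `y`'s component of primitive degree `i`
  let P₀ : {P : ℕ × ℕ // P.1 + 2 * P.2 = a} := ⟨(i, l), ha⟩
  have hq₀p : primitivePart η n hL hvan P₀ y ∈ primitiveClasses η n i := primitivePart_mem hL hvan P₀ y
  -- Lemme 1.3.1 on the top monomial `Lˡ q₀ ⊠ Lˡ p`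
  obtain ⟨c₀, hc₀, htop⟩ := lefschetzInvolution_boxSum_topMono' (η₁ := η) (η₂ := η) hX hX hΘ hq₀p hp hil hil
    (N := N) (by omega) (show i + i = 2 * i by omega) h₂
  refine ⟨(-1 : ℂ) ^ (a * a) * c₀ * (-1 : ℂ) ^ (i * i), by simp [hc₀], ?_⟩
  -- `z ∪ w = Lˡ w` for `z = Lˡ 1`
  have hz : ∀ w : complexBetti X (2 * i),
      cupPairing ν h₁ (lefschetzPowTo η l 0 (2 * l) h0 (singularCohomology.one ℂ (ComplexPoints X))) w =
        kroneckerPairing ℂ ℂ (ComplexPoints X) (2 * n) (lefschetzPowTo η l (2 * i) (2 * n) (by omega) w)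
          ν.fundamentalClass := by
    intro w
    rw [cupPairing_apply, cupProduct_lefschetzPowTo_left η l h0 h₁ (Nat.zero_add (2 * i)) (by omega), one_cupProduct]
  -- master formula, then expand `y`
  rw [cupPairing_corrClassAction_star_gysinDiag hX hΘ μ ν hμ hν h₁ h₂ hab hq hN (by omega), hz]
  conv_lhs => rw [← sum_lefschetzPowTo_primitivePart hL hvan y]
  simp only [map_sum, LinearMap.sum_apply]
  rw [Finset.sum_eq_single P₀]
  · -- the top term
    rw [mono_congr (η₁ := η) (η₂ := η) (p := primitivePart η n hL hvan P₀ y) (q := p) l l ha ha hN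
        (by omega : i + 2 * l + (i + 2 * l) = N),
      htop, map_smul, map_smul, map_lift_cross,
      ← cupProduct_lefschetzPowTo_left η l ha (show a + i = 2 * n by omega) (show i + i = 2 * i by omega) (by omega)
        (primitivePart η n hL hvan P₀ y) p,
      cupProduct_lefschetzPowTo_swap η ha (show a + i = 2 * n by omega) p (primitivePart η n hL hvan P₀ y),
      SmoothFamilyGysinKernel.cupProduct_lefschetzPowTo_primitivePart_eq η hL hvan P₀ hp y hil ha (show a + i = 2 * n by omega)
        (by omega : i + l + 0 = n) (show i + 2 * 0 = i by omega) hq,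
      lefschetzPowTo_zero_eq_id, LinearMap.id_apply, cupPairing_apply]
    simp only [map_smul, LinearMap.smul_apply, smul_eq_mul]
    ring
  · -- the other components vanish
    rintro P - hP
    have hne : P.1.1 ≠ i := by
      intro hPi
      apply hP
      have h2 := P.2
      exact Subtype.ext (Prod.ext hPi (by simp only [P₀]; omega))
    rw [mono_congr (η₁ := η) (η₂ := η) (p := primitivePart η n hL hvan P y) (q := p) P.1.2 l P.2 ha hN
        (by have := P.2; omega : P.1.1 + 2 * P.1.2 + (i + 2 * l) = N),
      lefschetzPowTo_map_lift_eq_zero_of_mem_block (primitivePart_mem hL hvan P y) hp hne (by omega)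
        (lefschetzInvolution_boxSum_mem_block hX hX hL hL hΘ (primitivePart_mem hL hvan P y) hp h₂
          (mono_mem_block η η _ p _ _ _ _))]
    simp only [map_zero, LinearMap.zero_apply]
  · intro h
    exact absurd (Finset.mem_univ _) h

/-! ## §4 The motivated correspondence `*_Θ(Δ_* Lˡ 1)` inverts `Lˡ` on the top of the strings of length `l` -/

/-- **André's Prop. 2.2 engine on the real carriers.** `X` smooth projective of dimension `n`, `η` with the hard
Lefschetz property, `Θ = fst^* η + snd^* η` (hard Lefschetz on `X ⊗ X`), `μ`, `ν` orientations with Poincaré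
duality, `i + l = n`, `p ∈ Pⁱ` primitive. Then the correspondence `u = *_Θ(Δ_*(Lˡ 1)) ∈ H^{2i}((X ⊗ X)(ℂ); ℂ)`
satisfies `u^*(Lˡ p) = λ • p` for some `λ ≠ 0` («un élément … induisant l'inverse de `L^{d-i}` sur
`L^{d-i}Pⁱ(X)`», up to the factor `K`): by §3 the linear forms `⟨u^*(Lˡ p), ·⟩` and `⟨p, ·⟩` on `Hᵃ(X(ℂ))` have
nested kernels, hence are proportional (`exists_eq_smul_of_ker_le`), and the cup pairing of the closed oriented
manifold `X(ℂ)` is perfect (Hatcher Prop. 3.38, `isPerfPair_cupPairing_of_field_holds`).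
[cite: Andre1996Motifs, Prop. 2.2 (p. 16)] [cite: Kleiman1968AlgebraicCycles, §1.4 (1.4.4–1.4.6)]
[cite: HatcherAT2002, §3.3 Prop. 3.38] -/
theorem exists_corrClassAction_star_lefschetzPowTo_eq_smul (hX : IsSmoothProjective n X)
    (hL : HasHardLefschetzProperty η n)
    (hΘ : HasHardLefschetzProperty (complexBetti.map (fst X X) 2 η + complexBetti.map (snd X X) 2 η) (n + n))
    (μ : HomologicalOrientation ℂ (ComplexPoints (X ⊗ X)) (2 * (n + n)))
    (ν : HomologicalOrientation ℂ (ComplexPoints X) (2 * n)) (hμ : μ.HasPoincareDuality) (hν : ν.HasPoincareDuality)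
    {i l a N : ℕ} (hil : i + l = n) (ha : i + 2 * l = a) (h0 : 0 + 2 * l = 2 * l) (h₁ : 2 * l + 2 * i = 2 * n)
    (hN : a + a = N) (h₂ : N + 2 * i = 2 * (n + n)) (hab : a + 2 * i = i + 2 * n) (hq : i + a = 2 * n)
    {p : complexBetti X i} (hp : p ∈ primitiveClasses η n i) :
    ∃ c : ℂ, c ≠ 0 ∧
      corrClassAction μ ν hab hq
          (lefschetzInvolution hΘ h₂
            (gysinMap ν μ (AlgPoints.mapContinuous (L := ℂ) (lift (𝟙 X) (𝟙 X))) h₁ h₂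
              (lefschetzPowTo η l 0 (2 * l) h0 (singularCohomology.one ℂ (ComplexPoints X)))))
          (lefschetzPowTo η l i a ha p) = c • p := by
  set T := corrClassAction μ ν hab hq
    (lefschetzInvolution hΘ h₂
      (gysinMap ν μ (AlgPoints.mapContinuous (L := ℂ) (lift (𝟙 X) (𝟙 X))) h₁ h₂
        (lefschetzPowTo η l 0 (2 * l) h0 (singularCohomology.one ℂ (ComplexPoints X))))) with hT
  have key : ∀ y, ∃ C : ℂ, C ≠ 0 ∧ cupPairing ν hq (T (lefschetzPowTo η l i a ha p)) y = C * cupPairing ν hq p y :=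
    fun y ↦ exists_cupPairing_corrClassAction_star_eq_mul hX hL hΘ μ ν hμ hν hil ha h0 h₁ hN h₂ hab hq hp y
  -- the two linear forms are proportional
  have hker : LinearMap.ker (cupPairing ν hq p) ≤ LinearMap.ker (cupPairing ν hq (T (lefschetzPowTo η l i a ha p))) := by
    intro y hy
    obtain ⟨C, -, hC⟩ := key y
    rw [LinearMap.mem_ker] at hy ⊢
    rw [hC, hy, mul_zero]
  obtain ⟨c, hc⟩ := exists_eq_smul_of_ker_le hker
  -- perfectness of the cup pairing of `X(ℂ)`
  letI := hX.chartedSpace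
  haveI := ComplexPoints.compactSpace_of_isSmoothProjective hX
  haveI := ComplexPoints.t2Space_of_isSmoothProjective hX
  have hP : (cupPairing ν hq).IsPerfPair := isPerfPair_cupPairing_of_field_holds
  have heq : T (lefschetzPowTo η l i a ha p) = c • p := by
    apply hP.bijective_left.1
    rw [map_smul, hc]
  by_cases hp0 : p = 0
  · refine ⟨1, one_ne_zero, ?_⟩
    rw [hp0, map_zero, map_zero, smul_zero]
  · refine ⟨c, ?_, heq⟩
    -- `⟨p, ·⟩ ≠ 0`, so some `⟨p, y⟩ ≠ 0`, and then `⟨T(Lˡ p), y⟩ ≠ 0`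
    have hne : cupPairing ν hq p ≠ 0 := fun h0' ↦ hp0 (hP.bijective_left.1 (by rw [h0', map_zero]))
    obtain ⟨y, hy⟩ : ∃ y, cupPairing ν hq p y ≠ 0 :=
      not_forall.mp fun hall ↦ hne (LinearMap.ext fun y ↦ (hall y).trans (LinearMap.zero_apply y).symm)
    obtain ⟨C, hC0, hC⟩ := key y
    intro hc0
    rw [heq, hc0, zero_smul, map_zero, LinearMap.zero_apply] at hC
    exact (mul_ne_zero hC0 hy) hC.symm

end Part2

end Literature.AlgebraicGeometry.HodgeTheory.MotivatedAlgebra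

end
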